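import Mathlib.Geometry.Manifold.Diffeomorph
import Mathlib.Geometry.Manifold.IsManifold.InteriorBoundary
import Literature.Topology.FourManifolds.Morse
import HarnessLib

/-!
# Manifold structure on `ULift M`: lifting manifolds and Morse data across universes

Topic `Literature/Topology/FourManifolds`; general infrastructure written for the fact seat
`provefact-Literature.IsHandlebody.exists_diffeomorph_isOrientationReversing_boundary`.  The named facts
of the topic quantify over manifolds `M : Type u` in an arbitrary universe (e.g.
`Literature.exists_isHandlebody_isOrientationReversing.{u}`: "for every `g` *some* genus-`g` handlebody
in `Type u` …"), while concrete models — subsets of `ℝ³`, spheres, balls — live in `Type`.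
This file provides the standard bridge: **`ULift.{v} M` is a manifold with the same charts as `M`,
canonically diffeomorphic to `M`, and Morse data are literally unchanged under the lift.**
Everything here is **proved** (mostly by `rfl`: the extended charts of `ULift M` are those of
`M` precomposed with `ULift.down`).

* §1 `Literature.Topology.FourManifolds.ManifoldULift.instChartedSpace` (charts `ul ≫ e`, `ul : ULift M → M` the tautological
  homeomorphism as an open partial homeomorphism, `e` a chart of `M`), `instHasGroupoid` (the
  chart changes of `ULift M` *are* the chart changes of `M`:
  `(ul ≫ e)⁻¹ ≫ (ul ≫ e') = e⁻¹ ≫ e'`, `symm_trans_eq`), `instIsManifold`;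
  `extChartAt I x = extChartAt I x.down ∘ down` (`extChartAt_apply`, `rfl`).
* §2 `contMDiff_down`, `contMDiff_up` (identity in charts), the diffeomorphism
  `Literature.ManifoldULift.diffeomorph I M n : ULift M ≃ₘ^n⟮I, I⟯ M`; second countability and
  connectedness of `ULift M` (Hausdorffness and compactness are already instances in Mathlib).
* §3 Morse data of `f ∘ down` versus `f` (notions of `Morse.lean`): `writtenInExtChartAt`,
  `mfderiv` (`mfderiv_comp_down`), critical points (`isMCriticalPt_comp_down_iff`,
  `criticalSet_comp_down`), the Hessian (`mhessian_comp_down`), the index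
  (`morseIndex_comp_down`), counts (`ncard_criticalSetOfIndex_comp_down`), `IsMorse`
  (`isMorse_comp_down_iff`), boundary and interior points (`boundary_eq`, `interior_eq`) and
  adapted Morse functions (`isMorseAdapted_comp_down_iff`) all correspond exactly.

Mathlib has the topology on `ULift` (`ULift.topologicalSpace`, `Homeomorph.ulift`) but no charted
space or manifold structure on it (`Mathlib.Geometry.Manifold.Bordism` notes the need to "`ULift`
`M`" and avoids it); `Homeomorph.chartedSpace` would give a structure with poor definitional
behaviour, whence the direct construction.

## References

* J. M. Lee, *Introduction to Smooth Manifolds*, 2nd ed., GTM 218 (2013), Ch. 1 (smooth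
  structures transported along homeomorphisms; diffeomorphism invariance). [LeeSmoothManifolds2013]
* J. Milnor, *Morse theory*, Ann. of Math. Studies 51 (1963), §2 (critical points, Hessian and
  index are defined in charts). [Milnor1963]
-/

open scoped Manifold ContDiff Topology
open Set Function Filter

noncomputable section

namespace Literature.Topology.FourManifolds

universe v u

namespace ManifoldULift

variable {H : Type*} [TopologicalSpace H] {M : Type u} [TopologicalSpace M]

/-- The homeomorphism `ULift M ≃ₜ M` as an open partial homeomorphism (source and target
`univ`). [folklore] -/
def ul (M : Type u) [TopologicalSpace M] : OpenPartialHomeomorph (ULift.{v} M) M :=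
  Homeomorph.ulift.toOpenPartialHomeomorph

/-- `ul x = x.down`. [folklore] -/
@[simp] theorem ul_apply (x : ULift.{v} M) : ul M x = x.down := rfl

/-- `ul⁻¹ x = up x`. [folklore] -/
@[simp] theorem ul_symm_apply (x : M) : (ul.{v} M).symm x = ULift.up x := rfl

/-- `ul` is defined everywhere. [folklore] -/
@[simp] theorem ul_source : (ul.{v} M).source = univ := rfl

/-- `ul` is onto. [folklore] -/
@[simp] theorem ul_target : (ul.{v} M).target = univ := rfl

/-- `ul⁻¹ ≫ ul = id`. [folklore] -/
theorem ul_symm_trans_ul : (ul.{v} M).symm.trans (ul.{v} M) = OpenPartialHomeomorph.refl M := by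
  rw [ul, ← Homeomorph.symm_toOpenPartialHomeomorph, ← Homeomorph.trans_toOpenPartialHomeomorph,
    Homeomorph.symm_trans_self, Homeomorph.refl_toOpenPartialHomeomorph]

/-- The key identity: `(ul ≫ e)⁻¹ ≫ (ul ≫ e') = e⁻¹ ≫ e'`. [folklore] -/
theorem symm_trans_eq (e e' : OpenPartialHomeomorph M H) :
    ((ul.{v} M).trans e).symm.trans ((ul.{v} M).trans e') = e.symm.trans e' := by
  rw [OpenPartialHomeomorph.trans_symm_eq_symm_trans_symm, OpenPartialHomeomorph.trans_assoc,
    ← OpenPartialHomeomorph.trans_assoc (ul M).symm, ul_symm_trans_ul,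
    OpenPartialHomeomorph.refl_trans]

variable [ChartedSpace H M]

/-- **The charted space structure on `ULift M`**: charts `ul ≫ e` for the charts `e` of `M`.
[folklore] -/
instance instChartedSpace : ChartedSpace H (ULift.{v} M) where
  atlas := (fun e => (ul.{v} M).trans e) '' atlas H M
  chartAt x := (ul.{v} M).trans (chartAt H x.down)
  mem_chart_source x := by simp [mem_chart_source]
  chart_mem_atlas x := mem_image_of_mem _ (chart_mem_atlas H x.down)

/-- The preferred chart of `ULift M` at `x` is `ul ≫ chartAt x.down`. [folklore] -/
theorem chartAt_eq (x : ULift.{v} M) : chartAt H x = (ul.{v} M).trans (chartAt H x.down) := rfl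

/-- The atlas of `ULift M` consists of the `ul ≫ e`, `e` in the atlas of `M`. [folklore] -/
theorem mem_atlas_iff {e : OpenPartialHomeomorph (ULift.{v} M) H} :
    e ∈ atlas H (ULift.{v} M) ↔ ∃ e' ∈ atlas H M, (ul.{v} M).trans e' = e := Iff.rfl

/-- Charts of `ULift M` evaluate as charts of `M`. [folklore] -/
@[simp] theorem chartAt_apply (x y : ULift.{v} M) : chartAt H x y = chartAt H x.down y.down := rfl

/-- Inverse charts of `ULift M`. [folklore] -/
@[simp] theorem chartAt_symm_apply (x : ULift.{v} M) (z : H) :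
    (chartAt H x).symm z = ULift.up ((chartAt H x.down).symm z) := rfl

/-- Chart sources of `ULift M`. [folklore] -/
theorem chartAt_source_ulift (x : ULift.{v} M) :
    (chartAt H x).source = ULift.down ⁻¹' (chartAt H x.down).source := by
  simp [chartAt_eq]; rfl

/-- Chart targets of `ULift M`. [folklore] -/
theorem chartAt_target_ulift (x : ULift.{v} M) :
    (chartAt H x).target = (chartAt H x.down).target := by
  rw [chartAt_eq, OpenPartialHomeomorph.trans_target]
  simp

/-- **`ULift M` has the same structure groupoid as `M`.** [folklore] -/
instance instHasGroupoid (G : StructureGroupoid H) [HasGroupoid M G] :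
    HasGroupoid (ULift.{v} M) G where
  compatible := by
    rintro _ _ ⟨e, he, rfl⟩ ⟨e', he', rfl⟩
    rw [symm_trans_eq]
    exact HasGroupoid.compatible he he'

variable {E : Type*} [NormedAddCommGroup E] [NormedSpace ℝ E] {I : ModelWithCorners ℝ E H}
  {n : WithTop ℕ∞}

/-- **`ULift M` is a `Cⁿ` manifold when `M` is.** [folklore] -/
instance instIsManifold [IsManifold I n M] : IsManifold I n (ULift.{v} M) where
  compatible := HasGroupoid.compatible (G := contDiffGroupoid n I)

/-- The extended charts of `ULift M`: `extChartAt I x = extChartAt I x.down ∘ down`. [folklore] -/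
@[simp] theorem extChartAt_apply (x y : ULift.{v} M) :
    extChartAt I x y = extChartAt I x.down y.down := rfl

/-- Inverse extended charts of `ULift M`. [folklore] -/
@[simp] theorem extChartAt_symm_apply (x : ULift.{v} M) (z : E) :
    (extChartAt I x).symm z = ULift.up ((extChartAt I x.down).symm z) := rfl

/-- Extended chart sources of `ULift M`. [folklore] -/
theorem extChartAt_source_ulift (x : ULift.{v} M) :
    (extChartAt I x).source = ULift.down ⁻¹' (extChartAt I x.down).source := by
  simp only [extChartAt_source, chartAt_source_ulift]

/-- Extended chart targets of `ULift M`. [folklore] -/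
theorem extChartAt_target_ulift (x : ULift.{v} M) :
    (extChartAt I x).target = (extChartAt I x.down).target := by
  simp only [extChartAt, OpenPartialHomeomorph.extend_target, chartAt_target_ulift]

/-! ### §2 `down`, `up` are smooth: the diffeomorphism `ULift M ≅ M`; topological instances -/

/-- `ULift M` is second countable when `M` is. [folklore] -/
instance instSecondCountableTopology [SecondCountableTopology M] :
    SecondCountableTopology (ULift.{v} M) :=
  Homeomorph.ulift.secondCountableTopology

/-- `ULift M` is connected when `M` is. [folklore] -/
instance instConnectedSpace [ConnectedSpace M] : ConnectedSpace (ULift.{v} M) :=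
  Homeomorph.ulift.symm.surjective.connectedSpace Homeomorph.ulift.symm.continuous

variable [IsManifold I n M]

/-- `down : ULift M → M` is `Cⁿ` (it is the identity in charts). [folklore] -/
theorem contMDiff_down : ContMDiff I I n (ULift.down : ULift.{v} M → M) := by
  rw [contMDiff_iff]
  refine ⟨continuous_uliftDown, fun x y => ?_⟩
  have h := (contMDiff_iff.1 (contMDiff_id (I := I) (M := M) (n := n))).2 x.down y
  have hfun : (extChartAt I y ∘ ULift.down ∘ (extChartAt I x).symm : E → E) =
      extChartAt I y ∘ id ∘ (extChartAt I x.down).symm := by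
    funext z; simp
  rw [hfun, extChartAt_target_ulift]
  exact h

/-- `up : M → ULift M` is `Cⁿ`. [folklore] -/
theorem contMDiff_up : ContMDiff I I n (ULift.up : M → ULift.{v} M) := by
  rw [contMDiff_iff]
  refine ⟨continuous_uliftUp, fun x y => ?_⟩
  have h := (contMDiff_iff.1 (contMDiff_id (I := I) (M := M) (n := n))).2 x y.down
  have hfun : (extChartAt I y ∘ ULift.up ∘ (extChartAt I x).symm : E → E) =
      extChartAt I y.down ∘ id ∘ (extChartAt I x).symm := by
    funext z; simp
  rw [hfun, extChartAt_source_ulift]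
  exact h

/-- **The canonical diffeomorphism `ULift N ≅ N`.** [folklore] -/
def diffeomorph (I : ModelWithCorners ℝ E H) (N : Type u) [TopologicalSpace N] [ChartedSpace H N]
    (n : WithTop ℕ∞) [IsManifold I n N] : ULift.{v} N ≃ₘ^n⟮I, I⟯ N where
  toEquiv := Equiv.ulift
  contMDiff_toFun := contMDiff_down
  contMDiff_invFun := contMDiff_up

/-- The diffeomorphism is `down`. [folklore] -/
@[simp] theorem diffeomorph_apply (x : ULift.{v} M) : diffeomorph I M n x = x.down := rfl

/-- Its inverse is `up`. [folklore] -/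
@[simp] theorem diffeomorph_symm_apply (x : M) : (diffeomorph.{v} I M n).symm x = ULift.up x :=
  rfl

/-! ### §3 Morse data of `f ∘ down` -/

omit [IsManifold I n M] in
/-- `f ∘ down` written in the extended chart at `x` is `f` written in the extended chart at
`x.down` (the same function `E → ℝ`). [folklore] -/
theorem writtenInExtChartAt_comp_down (f : M → ℝ) (x : ULift.{v} M) :
    writtenInExtChartAt I 𝓘(ℝ, ℝ) x (f ∘ ULift.down) =
      writtenInExtChartAt I 𝓘(ℝ, ℝ) x.down f := by
  funext z
  simp [writtenInExtChartAt]

omit [IsManifold I n M] in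
/-- Differentiability of `f ∘ down` at `x` is differentiability of `f` at `x.down`. [folklore] -/
theorem mdifferentiableAt_comp_down_iff (f : M → ℝ) (x : ULift.{v} M) :
    MDifferentiableAt I 𝓘(ℝ, ℝ) (f ∘ ULift.down) x ↔
      MDifferentiableAt I 𝓘(ℝ, ℝ) f x.down := by
  rw [mdifferentiableAt_iff, mdifferentiableAt_iff, writtenInExtChartAt_comp_down,
    extChartAt_apply]
  refine and_congr ?_ Iff.rfl
  constructor
  · intro h
    have : ContinuousAt ((f ∘ ULift.down) ∘ ULift.up) x.down :=
      h.comp continuous_uliftUp.continuousAt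
    simpa [Function.comp_def] using this
  · intro h
    exact h.comp continuous_uliftDown.continuousAt

omit [IsManifold I n M] in
/-- **The differential of `f ∘ down` at `x` is that of `f` at `x.down`** (same extended
charts). [folklore] -/
theorem mfderiv_comp_down (f : M → ℝ) (x : ULift.{v} M) :
    mfderiv I 𝓘(ℝ, ℝ) (f ∘ ULift.down) x = mfderiv I 𝓘(ℝ, ℝ) f x.down := by
  by_cases h : MDifferentiableAt I 𝓘(ℝ, ℝ) f x.down
  · have h' : MDifferentiableAt I 𝓘(ℝ, ℝ) (f ∘ ULift.down) x :=
      (mdifferentiableAt_comp_down_iff f x).2 h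
    rw [mfderiv, if_pos h', mfderiv, if_pos h, writtenInExtChartAt_comp_down, extChartAt_apply]
  · have h' : ¬ MDifferentiableAt I 𝓘(ℝ, ℝ) (f ∘ ULift.down) x :=
      fun h' => h ((mdifferentiableAt_comp_down_iff f x).1 h')
    rw [mfderiv_zero_of_not_mdifferentiableAt h, mfderiv_zero_of_not_mdifferentiableAt h']
    rfl

omit [IsManifold I n M] in
/-- Critical points of `f ∘ down` are the lifts of the critical points of `f`. [folklore] -/
theorem isMCriticalPt_comp_down_iff (f : M → ℝ) (x : ULift.{v} M) :
    IsMCriticalPt I (f ∘ ULift.down) x ↔ IsMCriticalPt I f x.down := by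
  rw [IsMCriticalPt, IsMCriticalPt, mfderiv_comp_down]
  exact Iff.rfl

omit [IsManifold I n M] in
/-- **The Hessian of `f ∘ down` at `x` is the Hessian of `f` at `x.down`** (same extended
charts). [folklore] -/
theorem mhessian_comp_down (f : M → ℝ) (x : ULift.{v} M) :
    mhessian I (f ∘ ULift.down) x = mhessian I f x.down := by
  simp only [mhessian, writtenInExtChartAt_comp_down, extChartAt_apply]

omit [IsManifold I n M] in
/-- The Morse index is unchanged by lifting. [folklore] -/
theorem morseIndex_comp_down (f : M → ℝ) (x : ULift.{v} M) :
    morseIndex I (f ∘ ULift.down) x = morseIndex I f x.down := by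
  rw [morseIndex, morseIndex, mhessian_comp_down]

omit [IsManifold I n M] in
/-- `crit (f ∘ down) = down⁻¹ (crit f)`. [folklore] -/
theorem criticalSet_comp_down (f : M → ℝ) :
    criticalSet I (f ∘ ULift.down) = (ULift.down : ULift.{v} M → M) ⁻¹' criticalSet I f := by
  ext x; exact isMCriticalPt_comp_down_iff f x

omit [IsManifold I n M] in
/-- `Crit_k (f ∘ down) = down⁻¹ (Crit_k f)`. [folklore] -/
theorem criticalSetOfIndex_comp_down (f : M → ℝ) (k : ℕ) :
    criticalSetOfIndex I (f ∘ ULift.down) k =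
      (ULift.down : ULift.{v} M → M) ⁻¹' criticalSetOfIndex I f k := by
  ext x
  simp only [mem_criticalSetOfIndex, mem_preimage, isMCriticalPt_comp_down_iff,
    morseIndex_comp_down]

omit [IsManifold I n M] in
/-- The number of critical points of index `k` is unchanged by lifting. [folklore] -/
theorem ncard_criticalSetOfIndex_comp_down (f : M → ℝ) (k : ℕ) :
    (criticalSetOfIndex I (f ∘ (ULift.down : ULift.{v} M → M)) k).ncard =
      (criticalSetOfIndex I f k).ncard := by
  rw [criticalSetOfIndex_comp_down, ← image_eq_preimage_of_inverse ULift.down_up ULift.up_down,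
    ncard_image_of_injective _ ULift.up_injective]

/-- `f ∘ down` is a Morse function iff `f` is. [folklore] -/
theorem isMorse_comp_down_iff [IsManifold I ∞ M] (f : M → ℝ) :
    IsMorse I (f ∘ (ULift.down : ULift.{v} M → M)) ↔ IsMorse I f := by
  constructor
  · rintro ⟨hs, hnd⟩
    refine ⟨?_, fun x hx => ?_⟩
    · have := hs.comp (contMDiff_up (I := I) (M := M) (n := ∞))
      simpa [Function.comp_def] using this
    · have h := hnd (ULift.up x) ((isMCriticalPt_comp_down_iff f _).2 hx)
      rwa [mhessian_comp_down] at h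
  · rintro ⟨hs, hnd⟩
    refine ⟨hs.comp contMDiff_down, fun x hx => ?_⟩
    rw [mhessian_comp_down]
    exact hnd _ ((isMCriticalPt_comp_down_iff f x).1 hx)

omit [IsManifold I n M] in
/-- Boundary points of `ULift M` are the lifts of boundary points of `M`. [folklore] -/
theorem isBoundaryPoint_iff (x : ULift.{v} M) :
    I.IsBoundaryPoint x ↔ I.IsBoundaryPoint x.down := by
  rw [ModelWithCorners.IsBoundaryPoint, ModelWithCorners.IsBoundaryPoint, extChartAt_apply]

omit [IsManifold I n M] in
/-- Interior points of `ULift M` are the lifts of interior points of `M`. [folklore] -/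
theorem isInteriorPoint_iff (x : ULift.{v} M) :
    I.IsInteriorPoint x ↔ I.IsInteriorPoint x.down := by
  rw [ModelWithCorners.IsInteriorPoint, ModelWithCorners.IsInteriorPoint, extChartAt_apply]

omit [IsManifold I n M] in
/-- `∂(ULift M) = down⁻¹ (∂M)`. [folklore] -/
theorem boundary_eq : I.boundary (ULift.{v} M) = ULift.down ⁻¹' I.boundary M := by
  ext x; exact isBoundaryPoint_iff x

omit [IsManifold I n M] in
/-- `int(ULift M) = down⁻¹ (int M)`. [folklore] -/
theorem interior_eq : I.interior (ULift.{v} M) = ULift.down ⁻¹' I.interior M := by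
  ext x; exact isInteriorPoint_iff x

/-- **A Morse function adapted to the boundary lifts to one**: `f ∘ down` is adapted to
`∂(ULift M)` iff `f` is adapted to `∂M`. [folklore] -/
theorem isMorseAdapted_comp_down_iff [IsManifold I ∞ M] (f : M → ℝ) :
    IsMorseAdapted I (f ∘ (ULift.down : ULift.{v} M → M)) ↔ IsMorseAdapted I f := by
  simp only [IsMorseAdapted, isMorse_comp_down_iff, boundary_eq, interior_eq, mem_preimage,
    Function.comp_apply, isMCriticalPt_comp_down_iff]
  constructor
  · rintro ⟨h1, h2, h3⟩
    exact ⟨h1, fun x hx => h2 (ULift.up x) hx, fun x hx => h3 (ULift.up x) hx⟩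
  · rintro ⟨h1, h2, h3⟩
    exact ⟨h1, fun x hx => h2 x.down hx, fun x hx => h3 x.down hx⟩

end ManifoldULift

end Literature.Topology.FourManifolds
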